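import Summits.Ventures.CertifiedManyBodySolver.Theorems.M3x2EdgeSplitSymReplayPackedCollectSort
import HarnessLib

/-!
# SymReplay — ONE-INTEGER WORD KEYS: `wkey` is an order isomorphism for `pwordLt` (prefix-lexicographic) on bounded words

(team lb-sym, cell hub-lb; hub-lb-sym-eng-4 g3, 2026-08-28; module 3 of 4 of lever (α-T); the key and its isomorphism proof are
hub-lb-sym-eng-4 g2's «E8» text (unlanded then: no gain inside an INTERPRETED sort; it pays now as the key of a NATIVE ordered map);
ADDITIVE on `…PackedCollectSort`.)

`wkey B n w = Σᵢ (wᵢ+1)·B^(n−1−i)`; `CodesLt`; `wkey_lt`; **`pwordLt_eq_wkey_lt`** (order isomorphism on words with codes `< B − 1`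
and length `≤ n`); `wkey_inj`; the executable key `wkeyN pows w = (zipWith (·*·) (w.map Nat.succ) pows).sum` over precomputed
powers `powsB` (core list functions ⇒ native under the interpreter) with `wkeyN_eq`; bounds `maxCode`/`maxLen` read off a packed
polynomial with `codesLt_maxCode`, `length_le_maxLen`.

HONEST FRAMING: list theory about an existing executable / an interpreted replay-COST lever; certifies nothing; no bound of
record moves; no summit or crux statement is proved here; nothing here predicts superconductivity.
-/

namespace Summit.Ventures.CertifiedManyBodySolver.Theorems.SymReplay.PackedNF

open Summit.Ventures.CertifiedManyBodySolver.Theorems.SymReplay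

/-! ##### (a) the one-integer key and its order isomorphism (hub-lb-sym-eng-4 g2 «E8», unlanded then: no gain in an interpreted sort) -/

/-- `wkey B n w = Σᵢ (wᵢ+1)·B^(n−1−i)` (prefix-lexicographic order as one number; junk `0` past length `n`). -/
def wkey (B : ℕ) : ℕ → PWord → ℕ
  | _, [] => 0
  | 0, _ :: _ => 0
  | n + 1, c :: w => (c + 1) * B ^ n + wkey B n w

/-- Codes of `w` are below `B − 1`. -/
def CodesLt (B : ℕ) (w : PWord) : Prop := ∀ c ∈ w, c + 1 < B

/-- A bounded word's key is below `B^n`. -/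
theorem wkey_lt : ∀ (B n : ℕ) (w : PWord), 1 ≤ B → CodesLt B w → w.length ≤ n → wkey B n w < B ^ n
  | B, n, [], hB, _, _ => by rw [wkey]; exact Nat.pos_of_ne_zero (by positivity)
  | B, 0, c :: w, _, _, hl => by simp at hl
  | B, n + 1, c :: w, hB, hc, hl => by
    rw [wkey]
    have h1 : c + 1 + 1 ≤ B := hc c (by simp)
    have h2 : wkey B n w < B ^ n := wkey_lt B n w hB (fun c' hc' => hc c' (by simp [hc'])) (by simpa using hl)
    have h3 : (c + 1) * B ^ n + B ^ n ≤ B * B ^ n := by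
      have := Nat.mul_le_mul_right (B ^ n) h1
      rw [Nat.add_mul, Nat.one_mul] at this
      exact this
    rw [Nat.pow_succ, Nat.mul_comm (B ^ n) B]
    omega

/-- **Order isomorphism**: on words with codes `< B − 1` and length `≤ n`, `pwordLt` IS `<` on keys. -/
theorem pwordLt_eq_wkey_lt : ∀ (B n : ℕ) (u v : PWord), 1 ≤ B → CodesLt B u → CodesLt B v → u.length ≤ n →
    v.length ≤ n → pwordLt u v = decide (wkey B n u < wkey B n v)
  | B, n, [], [], _, _, _, _, _ => by simp [pwordLt]
  | B, 0, [], b :: v, _, _, _, _, hv => by simp at hv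
  | B, n + 1, [], b :: v, hB, _, _, _, _ => by
    rw [pwordLt, wkey, wkey]
    symm
    rw [decide_eq_true_eq]
    have : 0 < B ^ n := Nat.pos_of_ne_zero (by positivity)
    nlinarith
  | B, 0, a :: u, _, _, _, _, hu, _ => by simp at hu
  | B, n + 1, a :: u, [], _, _, _, _, _ => by rw [pwordLt, wkey, wkey]; simp
  | B, n + 1, a :: u, b :: v, hB, hu, hv, hlu, hlv => by
    have hu' : CodesLt B u := fun c hc => hu c (by simp [hc])
    have hv' : CodesLt B v := fun c hc => hv c (by simp [hc])
    have ku := wkey_lt B n u hB hu' (by simpa using hlu)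
    have kv := wkey_lt B n v hB hv' (by simpa using hlv)
    have ih := pwordLt_eq_wkey_lt B n u v hB hu' hv' (by simpa using hlu) (by simpa using hlv)
    rw [pwordLt, wkey, wkey, ih]
    rcases lt_trichotomy a b with hab | rfl | hab
    · have h1 : (a + 1) * B ^ n + B ^ n ≤ (b + 1) * B ^ n := by
        have := Nat.mul_le_mul_right (B ^ n) (show a + 1 + 1 ≤ b + 1 by omega)
        rw [Nat.add_mul, Nat.one_mul] at this
        exact this
      have lhs : decide (a < b) = true := decide_eq_true hab
      rw [lhs, Bool.true_or]
      symm; rw [decide_eq_true_eq]; omega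
    · simp
    · have h1 : (b + 1) * B ^ n + B ^ n ≤ (a + 1) * B ^ n := by
        have := Nat.mul_le_mul_right (B ^ n) (show b + 1 + 1 ≤ a + 1 by omega)
        rw [Nat.add_mul, Nat.one_mul] at this
        exact this
      have e1 : decide (a < b) = false := decide_eq_false (by omega)
      have e2 : (a == b) = false := by rw [beq_eq_false_iff_ne]; omega
      rw [e1, e2, Bool.false_and, Bool.or_false]
      symm; rw [decide_eq_false_iff_not]; omega

/-- **The key is injective** on bounded words. -/
theorem wkey_inj (B n : ℕ) (u v : PWord) (hB : 1 ≤ B) (hu : CodesLt B u) (hv : CodesLt B v) (hlu : u.length ≤ n)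
    (hlv : v.length ≤ n) (h : wkey B n u = wkey B n v) : u = v := by
  rcases pwordLt_total u v with h' | h' | h'
  · rw [pwordLt_eq_wkey_lt B n u v hB hu hv hlu hlv, decide_eq_true_eq] at h'; omega
  · exact h'
  · rw [pwordLt_eq_wkey_lt B n v u hB hv hu hlv hlu, decide_eq_true_eq] at h'; omega

/-- Powers `[B^(n−1), …, B, 1]`. -/
def powsB (B : ℕ) : ℕ → List ℕ
  | 0 => []
  | n + 1 => B ^ n :: powsB B n

/-- **Executable key** (native under the interpreter: `List.map`, `List.zipWith`, `List.sum` are core functions). -/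
def wkeyN (pows : List ℕ) (w : PWord) : ℕ := (List.zipWith (· * ·) (w.map Nat.succ) pows).sum

/-- The executable key is `wkey`. -/
theorem wkeyN_eq (B : ℕ) : ∀ (n : ℕ) (w : PWord), wkeyN (powsB B n) w = wkey B n w
  | n, [] => by cases n <;> simp [wkeyN, powsB, wkey]
  | 0, c :: w => by simp [wkeyN, powsB, wkey]
  | n + 1, c :: w => by
    have ih := wkeyN_eq B n w
    simp only [wkeyN, powsB, wkey, List.map_cons, List.zipWith_cons_cons, List.sum_cons] at ih ⊢
    rw [ih]

/-- Largest code occurring in `p` (`0` if none). -/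
def maxCode (p : PPoly) : ℕ := p.foldl (fun m t => t.2.foldl max m) 0

/-- Largest word length occurring in `p` (`0` if none). -/
def maxLen (p : PPoly) : ℕ := p.foldl (fun m t => max m t.2.length) 0

/-- `foldl max` bounds every element (codes). -/
theorem le_foldl_max_codes : ∀ (p : PPoly) (m : ℕ), m ≤ p.foldl (fun m t => t.2.foldl max m) m ∧
    ∀ t ∈ p, ∀ c ∈ t.2, c ≤ p.foldl (fun m t => t.2.foldl max m) m := by
  intro p
  induction p with
  | nil => intro m; simp
  | cons t p ih =>
    intro m
    have hw : ∀ (w : PWord) (m : ℕ), m ≤ w.foldl max m ∧ ∀ c ∈ w, c ≤ w.foldl max m := by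
      intro w
      induction w with
      | nil => intro m; simp
      | cons c w ihw =>
        intro m
        refine ⟨le_trans (le_max_left m c) (ihw _).1, fun c' hc' => ?_⟩
        rcases List.mem_cons.1 hc' with rfl | hc'
        · exact le_trans (le_max_right m _) (ihw _).1
        · exact (ihw _).2 c' hc'
    rw [List.foldl_cons]
    refine ⟨le_trans (hw t.2 m).1 (ih _).1, fun t' ht' c hc => ?_⟩
    rcases List.mem_cons.1 ht' with rfl | ht'
    · exact le_trans ((hw _ m).2 c hc) (ih _).1
    · exact (ih _).2 t' ht' c hc

/-- `foldl max` bounds every element (lengths). -/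
theorem le_foldl_max_len : ∀ (p : PPoly) (m : ℕ), m ≤ p.foldl (fun m t => max m t.2.length) m ∧
    ∀ t ∈ p, t.2.length ≤ p.foldl (fun m t => max m t.2.length) m := by
  intro p
  induction p with
  | nil => intro m; simp
  | cons t p ih =>
    intro m
    rw [List.foldl_cons]
    refine ⟨le_trans (le_max_left _ _) (ih _).1, fun t' ht' => ?_⟩
    rcases List.mem_cons.1 ht' with rfl | ht'
    · exact le_trans (le_max_right _ _) (ih _).1
    · exact (ih _).2 t' ht'

/-- Every word of `p` has codes below `maxCode p + 2 − 1`. -/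
theorem codesLt_maxCode (p : PPoly) : ∀ t ∈ p, CodesLt (maxCode p + 2) t.2 :=
  fun t ht c hc => by have := (le_foldl_max_codes p 0).2 t ht c hc; unfold maxCode; omega

/-- Every word of `p` has length at most `maxLen p`. -/
theorem length_le_maxLen (p : PPoly) : ∀ t ∈ p, t.2.length ≤ maxLen p :=
  fun t ht => (le_foldl_max_len p 0).2 t ht

end Summit.Ventures.CertifiedManyBodySolver.Theorems.SymReplay.PackedNF
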